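import Summits.HubbardSuperconductivity.HubbardSuperconductivity.Theorems.WidthHaldaneTubeBlochBound
import Summits.HubbardSuperconductivity.HubbardSuperconductivity.Theorems.WidthHaldaneBridge.Negative.UniformThermoVoidRegion

/-!
# The two cruxes of route `WidthHaldane` are complementary

Crux `WidthHaldaneBridge` (stmt-HubbardSuperconductivity-16311; routes `WidthHaldane`, `SeamInduction`)
is the implication "width-uniform tube thermodynamics `UniformThermo U δ d₀ k₀ M₁ L₀` ⇒ a Haldane-form
law `HaldaneLaw U δ Ξ A R M₂ L₁`" for EVERY `U > 0`, `δ ∈ (0, 3/10)` and ALL data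
(`Theorems.WidthHaldane.widthHaldaneBridge_iff`). Its sibling crux `WidthUniformThermodynamics`
(stmt-HubbardSuperconductivity-16312) is the EXISTENCE of one point and one data set with
`UniformThermo` (`widthUniformThermodynamics_iff`). The hypothesis of the former is literally the
matrix of the latter, so — with no physics at all — the two items are logically linked as follows
(all kernel-checked here, over the landed tube vocabulary `Theorems/WidthHaldaneDefs.lean`):

* `widthHaldaneBridge_of_not_widthUniformThermodynamics` — **¬(16312) → (16311)**: if the pure Hubbard
  tubes have width-uniform thermodynamics NOWHERE in the window, the Bridge holds for lack of
  instances (the "vacuity world"; refuter cdisprove's `Disproof.lean §1` states the pointwise form);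
* `widthUniformThermodynamics_or_widthHaldaneBridge` — hence **(16312) ∨ (16311)** is a theorem:
  the two cruxes of the route cannot both fail, and a refutation of either one PROVES the other;
* `widthHaldaneBridge_iff_imp` — the Bridge is equivalent to its relativisation
  `WidthUniformThermodynamics → WidthHaldaneBridge`; `hubbardSuperconductivity_of_imp` — the route's
  deciding theorem `WidthHaldane.closes` therefore needs only the relativised Bridge;
* `not_widthHaldaneBridge_iff` — **the exact shape of a refutation**: `¬ WidthHaldaneBridge` iff at
  some window point there are CALIBRATED data `0 < d₀ ≤ 2`, `0 < k₀` (Bloch ceiling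
  `uniformThermo_floor_le_two`, `Negative.uniformThermo_false_of_nonpos`) with `UniformThermo` — i.e. a
  certified instance of stmt-16312 — at which the Haldane-form law fails for every admissible
  `(Ξ, A, R, M₂, L₁)`. In particular the item stmt-16311 is decidable only together with stmt-16312:
  its negation contains 16312, and the negation of 16312 contains it.
* `seamInduction_widthUniformThermodynamics_or_widthHaldaneBridge` — the same disjunction for the
  `SeamInduction` copies of the two decls (same text, `Iff.rfl`).

No definitions are introduced and no physics is used. Sources for the objects only: Haldane,
PRL 47 (1981) 1840 (form of the law); Scalapino–White–Zhang, PRB 47 (1993) 7995 §II (stiffness from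
the flux envelope).
-/

noncomputable section

namespace Summit.HubbardSuperconductivity.HubbardSuperconductivity.Theorems.WidthHaldane

set_option linter.dupNamespace false -- summit = problem name (single-conjunct summit), D-0017

open scoped BigOperators Classical Matrix ComplexConjugate
open Matrix Literature.MathematicalPhysics.QuantumLattice
open Summit.HubbardSuperconductivity.HubbardSuperconductivity.Theses.WidthHaldane
  (WidthHaldaneBridge WidthUniformThermodynamics closes)
open Summit.HubbardSuperconductivity.HubbardSuperconductivity.Theorems.WidthHaldaneBridge.Negative
  (uniformThermo_false_of_nonpos)

/-! ### The vacuity world and the disjunction -/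

/-- **¬(stmt-16312) → (stmt-16311).** If `WidthUniformThermodynamics` fails — no `U > 0`,
`δ ∈ (0, 3/10)` and data with width-uniform tube thermodynamics — then `WidthHaldaneBridge` holds,
because its hypothesis `UniformThermo U δ d₀ k₀ M₁ L₀` is never met. [folklore] -/
theorem widthHaldaneBridge_of_not_widthUniformThermodynamics (h : ¬ WidthUniformThermodynamics) :
    WidthHaldaneBridge := by
  rw [widthHaldaneBridge_iff]
  intro U hU δ hδ d₀ k₀ M₁ L₀ hd₀ hth
  exact absurd (widthUniformThermodynamics_iff.2 ⟨U, hU, δ, hδ, d₀, hd₀, k₀, M₁, L₀, hth⟩) h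

/-- **(stmt-16312) ∨ (stmt-16311)**: the two cruxes of route `WidthHaldane` cannot both be false;
a refutation of either one is a proof of the other. [folklore] -/
theorem widthUniformThermodynamics_or_widthHaldaneBridge :
    WidthUniformThermodynamics ∨ WidthHaldaneBridge :=
  (em WidthUniformThermodynamics).imp_right widthHaldaneBridge_of_not_widthUniformThermodynamics

/-- The Bridge is equivalent to its relativisation to the sibling crux: proving
`WidthUniformThermodynamics → WidthHaldaneBridge` proves the Bridge outright. [folklore] -/
theorem widthHaldaneBridge_iff_imp :
    WidthHaldaneBridge ↔ (WidthUniformThermodynamics → WidthHaldaneBridge) :=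
  ⟨fun h _ => h, fun h =>
    (em WidthUniformThermodynamics).elim h widthHaldaneBridge_of_not_widthUniformThermodynamics⟩

/-- Consequently the route's deciding theorem `WidthHaldane.closes` consumes only the RELATIVISED
Bridge: `(WidthUniformThermodynamics → WidthHaldaneBridge) → WidthUniformThermodynamics →
HubbardSuperconductivity`. [folklore] -/
theorem hubbardSuperconductivity_of_imp (h1 : WidthUniformThermodynamics → WidthHaldaneBridge)
    (h2 : WidthUniformThermodynamics) : HubbardSuperconductivity :=
  closes (h1 h2) h2

/-! ### The exact shape of a refutation -/

/-- **What `¬ WidthHaldaneBridge` is.** The Bridge fails iff at some `U > 0`, `δ ∈ (0, 3/10)` there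
are calibrated data `0 < d₀ ≤ 2`, `0 < k₀`, `M₁`, `L₀` such that the pure Hubbard tubes DO have
width-uniform thermodynamics `UniformThermo U δ d₀ k₀ M₁ L₀` (a certified, calibrated instance of
stmt-16312; the calibration is the a-priori Bloch ceiling `ρ̃ ≤ 2` and the clause `0 < ẽ″ ≤ k₀`) and
yet the Haldane-form law fails for every `Ξ > 0`, `A > 0`, `R`, `M₂`, `L₁`. [folklore] -/
theorem not_widthHaldaneBridge_iff :
    ¬ WidthHaldaneBridge ↔
      ∃ U : ℝ, 0 < U ∧ ∃ δ ∈ Set.Ioo (0 : ℝ) (3 / 10), ∃ d₀ : ℝ, 0 < d₀ ∧ d₀ ≤ 2 ∧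
        ∃ k₀ : ℝ, 0 < k₀ ∧ ∃ M₁ L₀ : ℕ, UniformThermo U δ d₀ k₀ M₁ L₀ ∧
          ∀ (Ξ A : ℝ) (R M₂ L₁ : ℕ), 0 < Ξ → 0 < A → ¬ HaldaneLaw U δ Ξ A R M₂ L₁ := by
  rw [widthHaldaneBridge_iff]
  constructor
  · intro h
    by_contra hc
    apply h
    intro U hU δ hδ d₀ k₀ M₁ L₀ hd₀ hth
    by_contra hc'
    apply hc
    refine ⟨U, hU, δ, hδ, d₀, hd₀, uniformThermo_floor_le_two hth, k₀, ?_, M₁, L₀, hth, ?_⟩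
    · by_contra hk
      exact uniformThermo_false_of_nonpos (not_lt.mp hk) hth
    · intro Ξ A R M₂ L₁ hΞ hA hlaw
      exact hc' ⟨Ξ, hΞ, A, hA, R, M₂, L₁, hlaw⟩
  · rintro ⟨U, hU, δ, hδ, d₀, hd₀, -, k₀, -, M₁, L₀, hth, hno⟩ h
    obtain ⟨Ξ, hΞ, A, hA, R, M₂, L₁, hlaw⟩ := h U hU δ hδ d₀ k₀ M₁ L₀ hd₀ hth
    exact hno Ξ A R M₂ L₁ hΞ hA hlaw

/-- One direction of `not_widthHaldaneBridge_iff` in the form planners quote: a refutation of the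
Bridge is a proof of `WidthUniformThermodynamics` (stmt-16312). [folklore] -/
theorem widthUniformThermodynamics_of_not_widthHaldaneBridge (h : ¬ WidthHaldaneBridge) :
    WidthUniformThermodynamics :=
  (widthUniformThermodynamics_or_widthHaldaneBridge).resolve_right h

/-! ### The `SeamInduction` copies -/

/-- The same disjunction for route `SeamInduction`'s copies of the two cruxes (identical texts,
`seamInduction_widthHaldaneBridge_iff`, `seamInduction_widthUniformThermodynamics_iff`). [folklore] -/
theorem seamInduction_widthUniformThermodynamics_or_widthHaldaneBridge :
    Summit.HubbardSuperconductivity.HubbardSuperconductivity.Theses.SeamInduction.WidthUniformThermodynamics ∨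
      Summit.HubbardSuperconductivity.HubbardSuperconductivity.Theses.SeamInduction.WidthHaldaneBridge := by
  rw [seamInduction_widthHaldaneBridge_iff, seamInduction_widthUniformThermodynamics_iff]
  exact widthUniformThermodynamics_or_widthHaldaneBridge

end Summit.HubbardSuperconductivity.HubbardSuperconductivity.Theorems.WidthHaldane

end
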